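import Summits.CriticalPhenomena.Ising3DConformalLimit.Theorems.LightConeRoundness.Negative.RoundKernelKL
import HarnessLib

/-!
# The hypotheses of the mechanism `TwoPointLightConeRigidity` (support stmt-CriticalPhenomena-17170 of the crux
`UnitLightCone.LightConeRoundness`, stmt-17169) are jointly satisfiable — no vacuous truth

Standing crux disprover (cdisprove, cycle 1), part IV.  With the landed representation `roundKernelAxisConeKL_half`
(`Negative/RoundKernelKL.lean`) the round kernel `K = 1/‖x‖` at `Δ = 1/2` meets EVERY hypothesis of the
model-blind rigidity lemma verbatim: `0 < Δ < 2`, continuity off `0`, positivity, homogeneity of degree `-2Δ`,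
invariance under the nine lattice mirrors (indeed under every reflection), and the two unit-cone Källén–Lehmann
representations (axis frame and face-diagonal frame, the SAME massless-shell measure).  Hence any refutation of
`TwoPointLightConeRigidity` needs a genuinely anisotropic kernel, and its hypothesis list is not contradictory.
-/

namespace Summit.CriticalPhenomena.Ising3DConformalLimit.Theorems.LightConeRoundness.Negative

open MeasureTheory

/-- The round kernel at `Δ = 1/2`: `K x = (‖x‖²)^(-1/2) = 1/‖x‖` off the origin (`0` at the origin). -/
noncomputable def roundHalfKernel (x : EuclideanSpace ℝ (Fin 3)) : ℝ := (‖x‖ ^ 2) ^ (-(1 / 2 : ℝ))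

/-- `‖a e₀ + b e₁ + t e₂‖² = a² + b² + t²`. -/
theorem norm_sq_axisPoint (a b t : ℝ) :
    ‖(EuclideanSpace.single 0 a + EuclideanSpace.single 1 b + EuclideanSpace.single 2 t :
      EuclideanSpace ℝ (Fin 3))‖ ^ 2 = a ^ 2 + b ^ 2 + t ^ 2 := by
  rw [EuclideanSpace.real_norm_sq_eq]
  simp [Fin.sum_univ_three]

/-- `‖((t+u)/√2) e₀ + ((t-u)/√2) e₁ + v e₂‖² = u² + v² + t²`. -/
theorem norm_sq_diagPoint (t u v : ℝ) :
    ‖(EuclideanSpace.single 0 ((t + u) / Real.sqrt 2) + EuclideanSpace.single 1 ((t - u) / Real.sqrt 2) +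
      EuclideanSpace.single 2 v : EuclideanSpace ℝ (Fin 3))‖ ^ 2 = u ^ 2 + v ^ 2 + t ^ 2 := by
  rw [EuclideanSpace.real_norm_sq_eq]
  simp only [Fin.sum_univ_three, PiLp.add_apply, PiLp.single_apply]
  simp only [Fin.isValue, ↓reduceIte, Fin.zero_eq_one_iff, OfNat.ofNat_ne_one, Fin.reduceEq, add_zero,
    Fin.one_eq_zero_iff, zero_add, div_pow, Real.sq_sqrt (by norm_num : (0:ℝ) ≤ 2)]
  ring

/-- **Non-vacuity of `TwoPointLightConeRigidity`.**  Its hypothesis list (verbatim) is satisfied by `Δ = 1/2`,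
`K = roundHalfKernel`. -/
theorem twoPointLightConeRigidity_hypotheses_satisfiable :
    ∃ (Δ : ℝ) (K : EuclideanSpace ℝ (Fin 3) → ℝ), 0 < Δ ∧ Δ < 2 ∧ ContinuousOn K {0}ᶜ ∧
      (∀ x, x ≠ 0 → 0 < K x) ∧ (∀ c : ℝ, 0 < c → ∀ x, K (c • x) = c ^ (-(2 * Δ)) * K x) ∧
      (∀ n : EuclideanSpace ℝ (Fin 3), (∃ i j : Fin 3, i ≠ j ∧ (n = EuclideanSpace.single i 1 ∨
          n = EuclideanSpace.single i 1 + EuclideanSpace.single j 1 ∨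
          n = EuclideanSpace.single i 1 - EuclideanSpace.single j 1)) →
        ∀ x, K (((ℝ ∙ n)ᗮ).reflection x) = K x) ∧
      (∃ μ : Measure (EuclideanSpace ℝ (Fin 2) × ℝ), μ {p : EuclideanSpace ℝ (Fin 2) × ℝ | p.2 < ‖p.1‖} = 0 ∧
        (∀ t a b : ℝ, t ≠ 0 → K (EuclideanSpace.single 0 a + EuclideanSpace.single 1 b +
            EuclideanSpace.single 2 t) =
          ∫ p, Real.cos (p.1 0 * a + p.1 1 * b) * Real.exp (-(p.2 * |t|)) ∂μ)) ∧
      (∃ μ : Measure (EuclideanSpace ℝ (Fin 2) × ℝ), μ {p : EuclideanSpace ℝ (Fin 2) × ℝ | p.2 < ‖p.1‖} = 0 ∧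
        (∀ t u v : ℝ, t ≠ 0 → K (EuclideanSpace.single 0 ((t + u) / Real.sqrt 2) +
            EuclideanSpace.single 1 ((t - u) / Real.sqrt 2) + EuclideanSpace.single 2 v) =
          ∫ p, Real.cos (p.1 0 * u + p.1 1 * v) * Real.exp (-(p.2 * |t|)) ∂μ)) := by
  obtain ⟨μ, hμ, hrep⟩ := roundKernelAxisConeKL_half
  refine ⟨1 / 2, roundHalfKernel, by norm_num, by norm_num, ?_, ?_, ?_, ?_, ⟨μ, hμ, ?_⟩, ⟨μ, hμ, ?_⟩⟩
  · -- continuity off the origin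
    refine ((continuous_norm.pow 2).continuousOn.rpow_const fun x hx => Or.inl ?_)
    have hx' : x ≠ 0 := fun h => hx (by simp [h])
    exact pow_ne_zero 2 (norm_ne_zero_iff.mpr hx')
  · -- positivity
    intro x hx
    exact Real.rpow_pos_of_pos (by positivity) _
  · -- homogeneity of degree -1
    intro c hc x
    unfold roundHalfKernel
    rw [norm_smul, mul_pow, Real.mul_rpow (sq_nonneg _) (sq_nonneg _), Real.norm_eq_abs, sq_abs,
      ← Real.rpow_natCast c 2, ← Real.rpow_mul hc.le]
    norm_num
  · -- reflection invariance (every reflection is an isometry)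
    intro n _ x
    unfold roundHalfKernel
    rw [LinearIsometryEquiv.norm_map]
  · -- axis frame
    intro t a b ht
    unfold roundHalfKernel
    rw [norm_sq_axisPoint]
    exact hrep t a b ht
  · -- diagonal frame: same measure, by roundness
    intro t u v ht
    unfold roundHalfKernel
    rw [norm_sq_diagPoint]
    exact hrep t u v ht

end Summit.CriticalPhenomena.Ising3DConformalLimit.Theorems.LightConeRoundness.Negative
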